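/-
Copyright (c) 2026. All rights reserved.
Released under Apache 2.0 license as described in the file LICENSE.
Authors: HodgeCM publication cell (pub-hodgecm), GR lane, seat GR-2 (`pub-hodgecm-own-hyp34`).
-/
import Literature.NumberTheory.GelbartRogawski1991.Prop311PrintedUnitaryFrame
import Literature.NumberTheory.GelbartRogawski1991.Prop311PrintedCarriers
import HarnessLib

/-!
# [GelbartRogawski1991, §3.1, Prop. 3.1.1]: the PRINTED `Sp_𝐀(W)` in a `Φ`-orthogonal `E`-frame —
# `Prop311.adelicSp F E V Φ ≃* Sp(𝐀ᴺ × 𝐀ᴺ, alt (polar β_T))`, compatibly with `G(𝐀) ⊂ Sp_𝐀(W)` (the CARRIER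
# JUNCTION, symplectic side)

Topic `NumberTheory/GelbartRogawski1991`; namespace `Literature.NumberTheory.GelbartRogawski1991.Prop311`.
Definitions and proved lemmas only; nothing of [GelbartRogawski1991] is asserted; `Prop311AsPrinted` is untouched.

[GelbartRogawski1991, §3.1 p. 454 L40–42]: "*Let `(W, φ)` be the associated symplectic space over `F`. That is, `W`
coincides with `V`, but viewed as an `F`-vector space, and `φ = Tr_{E/F}(Φ)`.*"  The statement-exact typing renders
`Sp_𝐀(W)` as `Prop311.adelicSp F E V Φ = symplecticGroup (heisForm F E V Φ)` on `W_𝐀 = 𝐀 ⊗_F V`, `heisForm = ½ φ_𝐀`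
(renderings R6–R7), while the tree's symplectic carriers (`adelicToSymplectic`, the `Sp` of `cmSplittingDatum`) are
`symplecticGroup (polar β_T)` on `𝐀ᴺ × 𝐀ᴺ`, `β_T = Matrix.toLinearMap₂' 𝐀 (T ⊗ 1)` for a SYMMETRIC `T ∈ M_N(F)`.
For an `E`-basis `b` of `V` which is `Φ`-ORTHOGONAL with diagonal values `Φ(bᵢ, bᵢ) = fᵢ δ` (`fᵢ ∈ F`; such a basis
exists for every non-degenerate skew-Hermitian `Φ` — not proved here) and quadratic coordinates `E = F ⊕ F δ`,
`δ² = d`, this file proves, with `T := diag(-2 d fᵢ)` (`symplecticGram`):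

* §1 `Tr_{E/F} = 1 + σ` (`algebraMap_trace_eq_add`, `σ ≠ 1` as `σ δ = -δ ≠ 0`) and **`φ_𝐀 = 2 re_𝔸 ∘ tensorToAdele ∘ Φ_𝐀`**
  (`adelicTraceForm_eq_two_mul_re`): print's `φ_𝐀 = Tr(Φ) ⊗ 𝐀` read through the `𝐀 ⊗_F E → 𝔸_E` dictionary of
  `Prop311PrintedUnitaryFrame`;
* §2 in the orthogonal frame `gramMatrix b Φ = δ · (diag f ⊗ 1)` and **`φ_𝐀(x, y) = alt (polar β_T) (adelicFrame x, adelicFrame y)`**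
  (`adelicTraceForm_eq_alt_polar`, via the tree's `im_hermForm_map`), hence
  `alt (heisForm) (x, y) = alt (polar β_T) (adelicFrame x, adelicFrame y)` (`alt_heisForm_eq`);
* §3 **`mem_adelicSp_iff_frameConj_mem`** and the group isomorphism
  **`frameSp b : Prop311.adelicSp F E V Φ ≃* symplecticGroup (polar β_{T ⊗ 1})`**, `g ↦ adelicFrame ∘ g ∘ adelicFrame⁻¹`;
* §4 the unitary group of the frame: `UnitaryGroup.adelic F E σ N (gramMatrix b Φ) = UnitaryGroup.adelic F E σ N (T ⊗ 1)`
  (`adelic_gramMatrix_eq`, a unit scalar does not change a unitary group: `unitaryGroupOfForm_smul`), the isomorphism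
  **`frameUnitary' b : G(𝐀) ≃* UnitaryGroup.adelic F E σ N (T ⊗ 1)`**, and the COMPATIBILITY
  **`adelicToSymplectic ∘ frameUnitary' = frameSp ∘ adelicUnitaryToSp`** (`adelicToSymplectic_frameUnitary'`): print's tacit
  `ι : G(𝐀) ⊂ Sp_𝐀(W)` IS the tree's `adelicToSymplectic` in the frame.

Together with `Prop311PrintedUnitaryFrame` / `…UnitaryJunction` (the `GA` leg, its topology and rational points) this is
the `(Sp, GA, toSp)` part of an isomorphism between the splitting datum on the printed objects
(`Prop311PrintedSplittingDatum.printedDatum`) and a datum on the tree's matrix carriers; the `Mp` leg (unitary `ρ_ψ`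
versus the smooth Schrödinger model) is the separate roadmap of `Prop311AdelicCoordinates` / `Prop311RhoPsiL2`.

## References
* [GelbartRogawski1991] S. Gelbart, J. Rogawski, Invent. Math. 105 (1991) 445–472, §3.1 p. 454 L17–42, Prop. 3.1.1
  p. 455 L1–2.
* [MoeglinVignerasWaldspurger1987] C. Mœglin, M.-F. Vignéras, J.-L. Waldspurger, LNM 1291 (1987), Chap. 1 I.17–I.19
  (`U(V) ⊂ Sp(Res_{E/F} V)`).
* [Mok2014] C. P. Mok, Mem. AMS 235 (2015), §1 Notation p. 5.
-/

set_option autoImplicit false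

noncomputable section

open NumberField
open scoped TensorProduct Matrix
open Literature.NumberTheory.Automorphic
open Literature.NumberTheory.Automorphic.UnitaryGroup
open Literature.RepresentationTheory.HeisenbergGroup

namespace Literature.NumberTheory.GelbartRogawski1991

namespace Prop311

open QuadraticCoordinates

variable (F : Type) [Field F] [NumberField F]
variable (E : Type) [Field E] [NumberField E] [Algebra F E] [Algebra.IsQuadraticExtension F E]
variable (σ : E ≃ₐ[F] E) {δ : E} (hσδ : σ δ = -δ) (hδ : δ ≠ 0) {d : F} (hd : δ * δ = algebraMap F E d)
variable (V : Type) [AddCommGroup V] [Module F V] [Module E V] [IsScalarTower F E V]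
variable {n : ℕ} (b : Module.Basis (Fin n) E V)
variable (Φ : V →ₗ[F] V →ₗ[F] E)

/-! ## §1. `Tr_{E/F} = 1 + σ` and `φ_𝐀 = 2 re_𝔸 (Φ_𝐀)` -/

section Trace

include hσδ hδ in
/-- **`Tr_{E/F}(e) = e + ē`** in the quadratic extension `E/F` with conjugation `σ` (`Gal(E/F) = {1, σ}`).
[cite: GelbartRogawski1991, §1.1 p. 449 L26; §3.1 p. 454 L42] -/
theorem algebraMap_trace_eq_add (e : E) : algebraMap F E (Algebra.trace F E e) = e + σ e := by
  classical
  haveI : FiniteDimensional F E := Module.finite_of_finrank_eq_succ (Algebra.IsQuadraticExtension.finrank_eq_two F E)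
  haveI : IsGalois F E := inferInstance
  rw [trace_eq_sum_automorphisms]
  -- the conjugation is not the identity: `σ δ = -δ`, `δ ≠ 0`, characteristic `0`
  have hσ1 : σ ≠ 1 := fun h1 => by
    rw [h1, AlgEquiv.one_apply] at hσδ
    exact hδ (add_self_eq_zero.1 (eq_neg_iff_add_eq_zero.1 hσδ))
  have huniv : (Finset.univ : Finset (E ≃ₐ[F] E)) = {1, σ} := by
    symm
    apply Finset.eq_univ_of_card
    rw [Finset.card_pair (Ne.symm hσ1), ← Nat.card_eq_fintype_card, IsGalois.card_aut_eq_finrank,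
      Algebra.IsQuadraticExtension.finrank_eq_two F E]
  rw [huniv, Finset.sum_pair (Ne.symm hσ1), AlgEquiv.one_apply]

omit [Algebra.IsQuadraticExtension F E] in
/-- the adelic conjugation fixes `𝐀 ⊗ 1`. [cite: GelbartRogawski1991, §1.1 p. 449 L26–27] -/
theorem conjAdele_baseChange (t : AdeleRing (𝓞 F) F) :
    conjAdele F E σ (AdeleRing.baseChange F E t) = AdeleRing.baseChange F E t := by
  rw [conjAdele_apply, AdeleRing.smul_baseChange]

omit [NumberField F] [Algebra.IsQuadraticExtension F E] in
include hσδ in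
/-- the adelic conjugation negates `δ ⊗ 1`. [cite: GelbartRogawski1991, §1.1 p. 449 L26–27] -/
theorem conjAdele_delta :
    conjAdele F E σ (algebraMap E (AdeleRing (𝓞 E) E) δ) = -algebraMap E (AdeleRing (𝓞 E) E) δ := by
  rw [← algebraMap_conj, RingHom.coe_coe, hσδ, map_neg]

omit [Module E V] [IsScalarTower F E V] in
include hσδ hδ in
/-- **`(φ_𝐀(x, y)) ⊗ 1 = Θ(Φ_𝐀(x, y)) + σ_𝔸 Θ(Φ_𝐀(x, y))`** in `𝔸_E`, `Θ = tensorToAdele`: the base change of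
`φ = Tr_{E/F}(Φ)` is the adelic trace of the base change of `Φ`. [cite: GelbartRogawski1991, §3.1 p. 454 L40–42] -/
theorem baseChange_adelicTraceForm (x y : AdelicSpace F V) :
    AdeleRing.baseChange F E (adelicTraceForm F E V Φ x y) =
      tensorToAdele F E (adelicHermForm F E V Φ x y) + conjAdele F E σ (tensorToAdele F E (adelicHermForm F E V Φ x y)) := by
  induction x using TensorProduct.induction_on with
  | zero => simp only [map_zero, LinearMap.zero_apply, add_zero]
  | tmul t v =>
    induction y using TensorProduct.induction_on with
    | zero => simp only [map_zero, add_zero]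
    | tmul t' v' =>
      rw [adelicTraceForm, LinearMap.BilinForm.baseChange_tmul, adelicHermForm, LinearMap.BilinMap.baseChange_tmul,
        tensorToAdele_tmul, traceForm_apply, Algebra.smul_def, map_mul, AdeleRing.baseChange_algebraMap,
        algebraMap_trace_eq_add F E σ hσδ hδ]
      simp only [map_mul, map_add, conjAdele_baseChange, ← algebraMap_conj, RingHom.coe_coe]
      ring
    | add y₁ y₂ h₁ h₂ =>
      simp only [map_add, h₁, h₂]
      abel
  | add x₁ x₂ h₁ h₂ =>
    simp only [map_add, LinearMap.add_apply, h₁, h₂]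
    abel

omit [Module E V] [IsScalarTower F E V] in
include hσδ hδ hd in
/-- **`φ_𝐀(x, y) = 2 · re_𝔸 (Θ(Φ_𝐀(x, y)))`** (`z + σ_𝔸 z = (2 re_𝔸 z) ⊗ 1` and `𝐀 → 𝔸_E` injective).
[cite: GelbartRogawski1991, §3.1 p. 454 L40–42] -/
theorem adelicTraceForm_eq_two_mul_re (x y : AdelicSpace F V) :
    adelicTraceForm F E V Φ x y =
      2 * re (quadraticAdeleEquiv F E σ hσδ hδ).toAddEquiv (tensorToAdele F E (adelicHermForm F E V Φ x y)) := by
  apply AdeleRing.baseChange_injective F E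
  rw [baseChange_adelicTraceForm F E σ hσδ hδ V Φ,
    (isQuadraticCoordinates_adele E σ hσδ hδ hd).add_conj (conjAdele_baseChange F E σ) (conjAdele_delta F E σ hσδ)]

end Trace

/-! ## §2. The orthogonal frame: `φ_𝐀 = alt (polar β_T) ∘ adelicFrame` with `T = diag(-2 d fᵢ)` -/

section Orthogonal

variable (f : Fin n → F)

omit [NumberField F] [NumberField E] [Algebra.IsQuadraticExtension F E] [IsScalarTower F E V] in
/-- in a `Φ`-orthogonal basis with `Φ(bᵢ, bᵢ) = fᵢ δ` the Gram matrix is `δ · (diag f ⊗ 1)`.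
[cite: GelbartRogawski1991, §3.1 p. 454 L37–38] -/
theorem gramMatrix_eq_of_orthogonal (hb : ∀ i j, i ≠ j → Φ (b i) (b j) = 0)
    (hf : ∀ i, Φ (b i) (b i) = algebraMap F E (f i) * δ) :
    gramMatrix F E V b Φ = δ • (Matrix.diagonal f).map (algebraMap F E) := by
  ext i j
  rw [gramMatrix_apply, Matrix.smul_apply, Matrix.map_apply, smul_eq_mul]
  by_cases hij : i = j
  · subst hij
    rw [hf, Matrix.diagonal_apply_eq, mul_comm]
  · rw [hb j i (Ne.symm hij), Matrix.diagonal_apply_ne _ hij, map_zero, mul_zero]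

/-- **the real symmetric Gram matrix of the frame**: `T = diag(-2 d fᵢ) ∈ M_N(F)` — the symmetric matrix whose `polar`
form on `𝐀ᴺ × 𝐀ᴺ` has alternation `φ_𝐀` in the frame. [cite: GelbartRogawski1991, §3.1 p. 454 L40–42] -/
def symplecticGram (d : F) (f : Fin n → F) : Matrix (Fin n) (Fin n) F := Matrix.diagonal fun i => -2 * d * f i

omit [NumberField F] in
/-- `T` is symmetric. [cite: GelbartRogawski1991, §3.1 p. 454 L40–42] -/
theorem isSymm_symplecticGram (d : F) (f : Fin n → F) : (symplecticGram F d f).IsSymm := Matrix.isSymm_diagonal _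

omit [NumberField F] [NumberField E] [Algebra.IsQuadraticExtension F E] [IsScalarTower F E V] in
include hd in
/-- `gramMatrix b Φ = -(2δ)⁻¹ · (T ⊗ 1)`, i.e. `T ⊗ 1 = (-2δ) · gramMatrix b Φ`. [cite: GelbartRogawski1991, §3.1 p. 454 L37–42] -/
theorem symplecticGram_map_eq_smul_gramMatrix (hb : ∀ i j, i ≠ j → Φ (b i) (b j) = 0)
    (hf : ∀ i, Φ (b i) (b i) = algebraMap F E (f i) * δ) :
    (symplecticGram F d f).map (algebraMap F E) = (-2 * δ) • gramMatrix F E V b Φ := by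
  rw [gramMatrix_eq_of_orthogonal F E V b Φ f hb hf, smul_smul]
  ext i j
  rw [Matrix.map_apply, Matrix.smul_apply, Matrix.map_apply, smul_eq_mul, symplecticGram]
  by_cases hij : i = j
  · subst hij
    rw [Matrix.diagonal_apply_eq, Matrix.diagonal_apply_eq, map_mul, map_mul, map_neg, map_ofNat, ← hd]
    ring
  · rw [Matrix.diagonal_apply_ne _ hij, Matrix.diagonal_apply_ne _ hij, map_zero, mul_zero]

/-- the pairing `β_{T ⊗ 1} = Matrix.toLinearMap₂' 𝐀 (T ⊗ 1)` of the tree's adelic symplectic carrier `𝐀ᴺ × 𝐀ᴺ`.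
[cite: GelbartRogawski1991, §3.1 p. 454 L17–22] -/
abbrev framePairing (d : F) (f : Fin n → F) :
    (Fin n → AdeleRing (𝓞 F) F) →ₗ[AdeleRing (𝓞 F) F] (Fin n → AdeleRing (𝓞 F) F) →ₗ[AdeleRing (𝓞 F) F]
      AdeleRing (𝓞 F) F :=
  Matrix.toLinearMap₂' (AdeleRing (𝓞 F) F) ((symplecticGram F d f).map (algebraMap F (AdeleRing (𝓞 F) F)))

omit [NumberField F] in
/-- scaling the matrix scales the alternating form of the polar pairing. [cite: Weil1964, n° 5, p. 150] -/
theorem alt_polar_toLinearMap₂'_smul {R : Type*} [CommRing R] {m : Type*} [Fintype m] [DecidableEq m] (c : R)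
    (T : Matrix m m R) (p q : (m → R) × (m → R)) :
    alt (polar (Matrix.toLinearMap₂' R (c • T))) p q = c * alt (polar (Matrix.toLinearMap₂' R T)) p q := by
  simp only [alt_apply, polar_apply, map_smul, LinearMap.smul_apply, smul_eq_mul]
  ring

/-- **`φ_𝐀(x, y) = alt (polar β_T) (adelicFrame x, adelicFrame y)`** in a `Φ`-orthogonal frame with `Φ(bᵢ, bᵢ) = fᵢ δ`,
`T = diag(-2 d fᵢ)`: print's adelic symplectic form IS the alternating form of the tree's polarised Heisenberg group
`𝐀ᴺ × 𝐀ᴺ` (through `im_hermForm_map`: `im h = alt (polar β)`). [cite: GelbartRogawski1991, §3.1 p. 454 L17, L40–42] -/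
theorem adelicTraceForm_eq_alt_polar (hΦ₁ : ∀ (e : E) (x y : V), Φ (e • x) y = e * Φ x y)
    (hΦ₂ : ∀ (e : E) (x y : V), Φ x (e • y) = Φ x y * σ e) (hb : ∀ i j, i ≠ j → Φ (b i) (b j) = 0)
    (hf : ∀ i, Φ (b i) (b i) = algebraMap F E (f i) * δ) (x y : AdelicSpace F V) :
    adelicTraceForm F E V Φ x y =
      alt (polar (framePairing F d f)) (adelicFrame F E σ hσδ hδ hd V b x) (adelicFrame F E σ hσδ hδ hd V b y) := by
  have h𝔸 := isQuadraticCoordinates_adele E σ hσδ hδ hd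
  -- `Φ_𝐀` read in `𝔸_E` is `δ · h_{diag f ⊗ 1}(frameCoord y, frameCoord x)`
  have hG : (gramMatrix F E V b Φ).map (algebraMap E (AdeleRing (𝓞 E) E)) =
      algebraMap E (AdeleRing (𝓞 E) E) δ •
        (((Matrix.diagonal f).map (algebraMap F (AdeleRing (𝓞 F) F))).map (AdeleRing.baseChange F E)) := by
    rw [gramMatrix_eq_of_orthogonal F E V b Φ f hb hf]
    ext i j
    simp only [Matrix.map_apply, Matrix.smul_apply, smul_eq_mul, Matrix.diagonal_apply]
    split_ifs <;> simp only [map_mul, map_zero, mul_zero, AdeleRing.baseChange_algebraMap]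
  have hT : ((Matrix.diagonal f).map (algebraMap F (AdeleRing (𝓞 F) F))).IsSymm := (Matrix.isSymm_diagonal f).map _
  have hherm : ∀ X Y : Fin n → AdeleRing (𝓞 E) E,
      hermForm (conjAdele F E σ) ((gramMatrix F E V b Φ).map (algebraMap E (AdeleRing (𝓞 E) E))) X Y =
        algebraMap E (AdeleRing (𝓞 E) E) δ *
          hermForm (conjAdele F E σ) (((Matrix.diagonal f).map (algebraMap F (AdeleRing (𝓞 F) F))).map
            (AdeleRing.baseChange F E)) X Y := fun X Y => by
    rw [hG, hermForm_apply, hermForm_apply, Matrix.smul_mulVec, dotProduct_smul, smul_eq_mul]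
  rw [adelicTraceForm_eq_two_mul_re F E σ hσδ hδ hd V Φ, tensorToAdele_adelicHermForm F E σ hσδ hδ hd V b Φ hΦ₁ hΦ₂,
    hherm, h𝔸.re_delta_mul, h𝔸.im_hermForm_map (Fin n) hT (conjAdele_baseChange F E σ) (conjAdele_delta F E σ hσδ),
    reIm_frameCoord, reIm_frameCoord, framePairing, symplecticGram]
  -- `diag(-2 d f) ⊗ 1 = (-2d) • (diag f ⊗ 1)` and antisymmetry of `alt`
  have hdiag : (Matrix.diagonal fun i => -2 * d * f i).map (algebraMap F (AdeleRing (𝓞 F) F)) =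
      algebraMap F (AdeleRing (𝓞 F) F) (-2 * d) • (Matrix.diagonal f).map (algebraMap F (AdeleRing (𝓞 F) F)) := by
    ext i j
    rw [Matrix.map_apply, Matrix.smul_apply, Matrix.map_apply, smul_eq_mul]
    by_cases hij : i = j
    · subst hij; rw [Matrix.diagonal_apply_eq, Matrix.diagonal_apply_eq, map_mul]
    · rw [Matrix.diagonal_apply_ne _ hij, Matrix.diagonal_apply_ne _ hij, map_zero, mul_zero]
  rw [hdiag, alt_polar_toLinearMap₂'_smul, alt_apply, alt_apply, map_mul, map_neg, map_ofNat]
  ring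

/-- **`alt (heisForm) = alt (polar β_T) ∘ adelicFrame`**: the commutator forms of print's `H_𝐀(W)` (`B_𝐀 = ½ φ_𝐀`) and of
the tree's polarised Heisenberg group agree in the frame. [cite: GelbartRogawski1991, §3.1 p. 454 L17–22, L40–42] -/
theorem alt_heisForm_eq (hΦ₁ : ∀ (e : E) (x y : V), Φ (e • x) y = e * Φ x y)
    (hΦ₂ : ∀ (e : E) (x y : V), Φ x (e • y) = Φ x y * σ e) (hb : ∀ i j, i ≠ j → Φ (b i) (b j) = 0)
    (hf : ∀ i, Φ (b i) (b i) = algebraMap F E (f i) * δ) (x y : AdelicSpace F V) :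
    alt (heisForm F E V Φ) x y =
      alt (polar (framePairing F d f)) (adelicFrame F E σ hσδ hδ hd V b x) (adelicFrame F E σ hσδ hδ hd V b y) := by
  rw [alt_apply, heisForm]
  simp only [LinearMap.smul_apply]
  rw [adelicTraceForm_eq_alt_polar F E σ hσδ hδ hd V b Φ f hΦ₁ hΦ₂ hb hf x y,
    adelicTraceForm_eq_alt_polar F E σ hσδ hδ hd V b Φ f hΦ₁ hΦ₂ hb hf y x]
  set A := alt (polar (framePairing F d f))
  have hanti : A (adelicFrame F E σ hσδ hδ hd V b y) (adelicFrame F E σ hσδ hδ hd V b x) =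
      -A (adelicFrame F E σ hσδ hδ hd V b x) (adelicFrame F E σ hσδ hδ hd V b y) := by
    simp only [A, alt_apply]
    ring
  rw [hanti, smul_eq_mul, smul_eq_mul, mul_neg, sub_neg_eq_add, ← mul_add, ← two_mul, ← mul_assoc,
    invOf_mul_self, one_mul]

end Orthogonal

/-! ## §3. `Sp_𝐀(W)` (print) `≃*` `Sp(𝐀ᴺ × 𝐀ᴺ, alt (polar β_T))` (tree) -/

section Symplectic

variable (f : Fin n → F)

/-- **`g ∈ Sp_𝐀(W)` iff `adelicFrame ∘ g ∘ adelicFrame⁻¹ ∈ Sp(alt (polar β_T))`** (orthogonal frame).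
[cite: GelbartRogawski1991, §3.1 p. 454 L17–22, L40–42] -/
theorem mem_adelicSp_iff_frameConj_mem (hΦ₁ : ∀ (e : E) (x y : V), Φ (e • x) y = e * Φ x y)
    (hΦ₂ : ∀ (e : E) (x y : V), Φ x (e • y) = Φ x y * σ e) (hb : ∀ i j, i ≠ j → Φ (b i) (b j) = 0)
    (hf : ∀ i, Φ (b i) (b i) = algebraMap F E (f i) * δ) (g : AdelicSpace F V ≃ₗ[AdeleRing (𝓞 F) F] AdelicSpace F V) :
    g ∈ adelicSp F E V Φ ↔ frameConj F E σ hσδ hδ hd V b g ∈ symplecticGroup (polar (framePairing F d f)) := by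
  show g ∈ Heisenberg.PseudoSymplectic.isometries (alt (heisForm F E V Φ)) ↔
    frameConj F E σ hσδ hδ hd V b g ∈ Heisenberg.PseudoSymplectic.isometries (alt (polar (framePairing F d f)))
  rw [Heisenberg.PseudoSymplectic.mem_isometries, Heisenberg.PseudoSymplectic.mem_isometries]
  constructor
  · intro hg p q
    obtain ⟨x, rfl⟩ : ∃ x, adelicFrame F E σ hσδ hδ hd V b x = p :=
      ⟨(adelicFrame F E σ hσδ hδ hd V b).symm p, (adelicFrame F E σ hσδ hδ hd V b).apply_symm_apply p⟩
    obtain ⟨y, rfl⟩ : ∃ y, adelicFrame F E σ hσδ hδ hd V b y = q :=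
      ⟨(adelicFrame F E σ hσδ hδ hd V b).symm q, (adelicFrame F E σ hσδ hδ hd V b).apply_symm_apply q⟩
    rw [frameConj_apply_adelicFrame, frameConj_apply_adelicFrame,
      ← alt_heisForm_eq F E σ hσδ hδ hd V b Φ f hΦ₁ hΦ₂ hb hf, ← alt_heisForm_eq F E σ hσδ hδ hd V b Φ f hΦ₁ hΦ₂ hb hf,
      hg]
  · intro hg x y
    rw [alt_heisForm_eq F E σ hσδ hδ hd V b Φ f hΦ₁ hΦ₂ hb hf, alt_heisForm_eq F E σ hσδ hδ hd V b Φ f hΦ₁ hΦ₂ hb hf,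
      ← frameConj_apply_adelicFrame, ← frameConj_apply_adelicFrame, hg]

/-- the inverse conjugation `adelicFrame⁻¹ ∘ g' ∘ adelicFrame`. [cite: GelbartRogawski1991, §3.1 p. 454 L41–42] -/
def frameConjSymm (g' : ((Fin n → AdeleRing (𝓞 F) F) × (Fin n → AdeleRing (𝓞 F) F)) ≃ₗ[AdeleRing (𝓞 F) F]
    ((Fin n → AdeleRing (𝓞 F) F) × (Fin n → AdeleRing (𝓞 F) F))) :
    AdelicSpace F V ≃ₗ[AdeleRing (𝓞 F) F] AdelicSpace F V :=
  (adelicFrame F E σ hσδ hδ hd V b).trans (g'.trans (adelicFrame F E σ hσδ hδ hd V b).symm)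

/-- `frameConj (frameConjSymm g') = g'`. [cite: GelbartRogawski1991, §3.1 p. 454 L41–42] -/
@[simp] theorem frameConj_frameConjSymm
    (g' : ((Fin n → AdeleRing (𝓞 F) F) × (Fin n → AdeleRing (𝓞 F) F)) ≃ₗ[AdeleRing (𝓞 F) F]
      ((Fin n → AdeleRing (𝓞 F) F) × (Fin n → AdeleRing (𝓞 F) F))) :
    frameConj F E σ hσδ hδ hd V b (frameConjSymm F E σ hσδ hδ hd V b g') = g' := by
  refine LinearEquiv.ext fun p => ?_
  simp only [frameConj, frameConjSymm, LinearEquiv.trans_apply, LinearEquiv.apply_symm_apply]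

/-- `frameConjSymm (frameConj g) = g`. [cite: GelbartRogawski1991, §3.1 p. 454 L41–42] -/
@[simp] theorem frameConjSymm_frameConj (g : AdelicSpace F V ≃ₗ[AdeleRing (𝓞 F) F] AdelicSpace F V) :
    frameConjSymm F E σ hσδ hδ hd V b (frameConj F E σ hσδ hδ hd V b g) = g := by
  refine LinearEquiv.ext fun w => ?_
  simp only [frameConj, frameConjSymm, LinearEquiv.trans_apply, LinearEquiv.symm_apply_apply]

/-- **`frameSp b : Sp_𝐀(W) ≃* Sp(𝐀ᴺ × 𝐀ᴺ, alt (polar β_{T ⊗ 1}))`**, `g ↦ adelicFrame ∘ g ∘ adelicFrame⁻¹` — print's adelic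
symplectic group of `(W, φ = Tr Φ)` IS the tree's symplectic group of the polarised form `β_T`, `T = diag(-2 d fᵢ)`, in
a `Φ`-orthogonal frame. [cite: GelbartRogawski1991, §3.1 p. 454 L17–22, L40–42] -/
def frameSp (hΦ₁ : ∀ (e : E) (x y : V), Φ (e • x) y = e * Φ x y)
    (hΦ₂ : ∀ (e : E) (x y : V), Φ x (e • y) = Φ x y * σ e) (hb : ∀ i j, i ≠ j → Φ (b i) (b j) = 0)
    (hf : ∀ i, Φ (b i) (b i) = algebraMap F E (f i) * δ) :
    adelicSp F E V Φ ≃* symplecticGroup (polar (framePairing F d f)) where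
  toFun g := ⟨frameConj F E σ hσδ hδ hd V b g,
    (mem_adelicSp_iff_frameConj_mem F E σ hσδ hδ hd V b Φ f hΦ₁ hΦ₂ hb hf _).1 g.2⟩
  invFun g' := ⟨frameConjSymm F E σ hσδ hδ hd V b g',
    (mem_adelicSp_iff_frameConj_mem F E σ hσδ hδ hd V b Φ f hΦ₁ hΦ₂ hb hf _).2
      (by rw [frameConj_frameConjSymm]; exact g'.2)⟩
  left_inv g := Subtype.ext (frameConjSymm_frameConj F E σ hσδ hδ hd V b _)
  right_inv g' := Subtype.ext (frameConj_frameConjSymm F E σ hσδ hδ hd V b _)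
  map_mul' g g' := Subtype.ext (frameConj_mul F E σ hσδ hδ hd V b _ _)

/-- `frameSp b g` acts by `adelicFrame ∘ g ∘ adelicFrame⁻¹`. [cite: GelbartRogawski1991, §3.1 p. 454 L41–42] -/
@[simp] theorem coe_frameSp (hΦ₁ : ∀ (e : E) (x y : V), Φ (e • x) y = e * Φ x y)
    (hΦ₂ : ∀ (e : E) (x y : V), Φ x (e • y) = Φ x y * σ e) (hb : ∀ i j, i ≠ j → Φ (b i) (b j) = 0)
    (hf : ∀ i, Φ (b i) (b i) = algebraMap F E (f i) * δ) (g : adelicSp F E V Φ) :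
    ((frameSp F E σ hσδ hδ hd V b Φ f hΦ₁ hΦ₂ hb hf g : symplecticGroup (polar (framePairing F d f))) :
        ((Fin n → AdeleRing (𝓞 F) F) × (Fin n → AdeleRing (𝓞 F) F)) ≃ₗ[AdeleRing (𝓞 F) F]
          ((Fin n → AdeleRing (𝓞 F) F) × (Fin n → AdeleRing (𝓞 F) F))) =
      frameConj F E σ hσδ hδ hd V b g :=
  rfl

/-- `frameSp b g (adelicFrame w) = adelicFrame (g w)`. [cite: GelbartRogawski1991, §3.1 p. 454 L41–42] -/
theorem frameSp_apply_adelicFrame (hΦ₁ : ∀ (e : E) (x y : V), Φ (e • x) y = e * Φ x y)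
    (hΦ₂ : ∀ (e : E) (x y : V), Φ x (e • y) = Φ x y * σ e) (hb : ∀ i j, i ≠ j → Φ (b i) (b j) = 0)
    (hf : ∀ i, Φ (b i) (b i) = algebraMap F E (f i) * δ) (g : adelicSp F E V Φ) (w : AdelicSpace F V) :
    ((frameSp F E σ hσδ hδ hd V b Φ f hΦ₁ hΦ₂ hb hf g : symplecticGroup (polar (framePairing F d f))) :
        ((Fin n → AdeleRing (𝓞 F) F) × (Fin n → AdeleRing (𝓞 F) F)) ≃ₗ[AdeleRing (𝓞 F) F]
          ((Fin n → AdeleRing (𝓞 F) F) × (Fin n → AdeleRing (𝓞 F) F)))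
        (adelicFrame F E σ hσδ hδ hd V b w) =
      adelicFrame F E σ hσδ hδ hd V b ((g : AdelicSpace F V ≃ₗ[AdeleRing (𝓞 F) F] AdelicSpace F V) w) :=
  frameConj_apply_adelicFrame F E σ hσδ hδ hd V b _ w

end Symplectic

/-! ## §4. Compatibility with the unitary side: `adelicToSymplectic ∘ frameUnitary' = frameSp ∘ ι` -/

section Compatibility

variable (f : Fin n → F)

variable {S : Type*} [CommRing S] {m : Type*} [Fintype m] [DecidableEq m]

/-- **a unit scalar does not change a unitary group**: `U(τ, c H) = U(τ, H)` for `c` a unit.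
[cite: Mok2014, §1 Notation p. 5] -/
theorem unitaryGroupOfForm_smul (τ : S →+* S) (H : Matrix m m S) {c : S} (hc : IsUnit c) :
    unitaryGroupOfForm τ (c • H) = unitaryGroupOfForm τ H := by
  ext g
  rw [mem_unitaryGroupOfForm_iff, mem_unitaryGroupOfForm_iff, Matrix.mul_smul, Matrix.smul_mul]
  exact hc.smul_left_cancel

omit [NumberField F] [Algebra.IsQuadraticExtension F E] [IsScalarTower F E V] in
include hδ hd in
/-- **the frame's unitary groups coincide**: `U(gramMatrix b Φ)(𝔸_F) = U(T ⊗ 1)(𝔸_F)` (`T ⊗ 1 = (-2δ) · gramMatrix b Φ`,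
`-2δ` a unit). [cite: GelbartRogawski1991, §3.1 p. 454 L37–42] -/
theorem adelic_gramMatrix_eq (hb : ∀ i j, i ≠ j → Φ (b i) (b j) = 0) (hf : ∀ i, Φ (b i) (b i) = algebraMap F E (f i) * δ) :
    UnitaryGroup.adelic F E σ n (gramMatrix F E V b Φ) =
      UnitaryGroup.adelic F E σ n ((symplecticGram F d f).map (algebraMap F E)) := by
  have h2δ : IsUnit (algebraMap E (AdeleRing (𝓞 E) E) (-2 * δ)) :=
    (isUnit_iff_ne_zero.2 (mul_ne_zero (neg_ne_zero.2 two_ne_zero) hδ)).map _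
  rw [UnitaryGroup.adelic, UnitaryGroup.adelic, UnitaryGroup.adelicForm, UnitaryGroup.adelicForm,
    symplecticGram_map_eq_smul_gramMatrix F E hd V b Φ f hb hf,
    Matrix.map_smul' _ _ _ (map_mul (algebraMap E (AdeleRing (𝓞 E) E))), unitaryGroupOfForm_smul _ _ h2δ]

/-- **`frameUnitary' b : G(𝐀) ≃* U(T ⊗ 1)(𝔸_F)`**: `frameUnitary b` followed by the identity `U(gramMatrix) = U(T ⊗ 1)` — the
form in which the tree's `adelicToSymplectic` (which wants a REAL SYMMETRIC Gram matrix `T`) consumes print's `G(𝐀)`.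
[cite: GelbartRogawski1991, §3.1 p. 454 L37–42; Prop. 3.1.1 p. 455 L1] -/
def frameUnitary' (hΦ₁ : ∀ (e : E) (x y : V), Φ (e • x) y = e * Φ x y)
    (hΦ₂ : ∀ (e : E) (x y : V), Φ x (e • y) = Φ x y * σ e) (hb : ∀ i j, i ≠ j → Φ (b i) (b j) = 0)
    (hf : ∀ i, Φ (b i) (b i) = algebraMap F E (f i) * δ) :
    adelicUnitary F E V Φ ≃* UnitaryGroup.adelic F E σ n ((symplecticGram F d f).map (algebraMap F E)) :=
  (frameUnitary F E σ hσδ hδ hd V b Φ hΦ₁ hΦ₂).trans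
    (MulEquiv.subgroupCongr (adelic_gramMatrix_eq F E σ hδ hd V b Φ f hb hf))

/-- `frameUnitary' b g` has the same underlying matrix as `frameUnitary b g`. [cite: GelbartRogawski1991, §3.1 p. 454 L37–42] -/
@[simp] theorem coe_frameUnitary' (hΦ₁ : ∀ (e : E) (x y : V), Φ (e • x) y = e * Φ x y)
    (hΦ₂ : ∀ (e : E) (x y : V), Φ x (e • y) = Φ x y * σ e) (hb : ∀ i j, i ≠ j → Φ (b i) (b j) = 0)
    (hf : ∀ i, Φ (b i) (b i) = algebraMap F E (f i) * δ) (g : adelicUnitary F E V Φ) :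
    ((frameUnitary' F E σ hσδ hδ hd V b Φ f hΦ₁ hΦ₂ hb hf g :
        UnitaryGroup.adelic F E σ n ((symplecticGram F d f).map (algebraMap F E))) : GL (Fin n) (AdeleRing (𝓞 E) E)) =
      (frameUnitary F E σ hσδ hδ hd V b Φ hΦ₁ hΦ₂ g : UnitaryGroup.adelic F E σ n (gramMatrix F E V b Φ)) := by
  rw [frameUnitary', MulEquiv.trans_apply, MulEquiv.subgroupCongr_apply]

/-- **COMPATIBILITY `adelicToSymplectic ∘ frameUnitary' = frameSp ∘ ι`**: print's tacit inclusion `ι : G(𝐀) ⊂ Sp_𝐀(W)`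
(`adelicUnitaryToSp`) becomes, in the frame, the tree's `adelicToSymplectic : U(T ⊗ 1)(𝔸_F) →* Sp(𝐀ᴺ × 𝐀ᴺ, alt (polar β_T))`
(both are "`g` acting on `𝔸_Eᴺ`, written in the coordinates `reIm`").
[cite: GelbartRogawski1991, §3.1 p. 454 L37–42; Prop. 3.1.1 p. 455 L1] -/
theorem adelicToSymplectic_frameUnitary' (hΦ₁ : ∀ (e : E) (x y : V), Φ (e • x) y = e * Φ x y)
    (hΦ₂ : ∀ (e : E) (x y : V), Φ x (e • y) = Φ x y * σ e) (hb : ∀ i j, i ≠ j → Φ (b i) (b j) = 0)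
    (hf : ∀ i, Φ (b i) (b i) = algebraMap F E (f i) * δ) (g : adelicUnitary F E V Φ) :
    adelicToSymplectic F E σ n hσδ hδ hd ((isSymm_symplecticGram F d f)) rfl
        (frameUnitary' F E σ hσδ hδ hd V b Φ f hΦ₁ hΦ₂ hb hf g) =
      frameSp F E σ hσδ hδ hd V b Φ f hΦ₁ hΦ₂ hb hf (adelicUnitaryToSp F E V Φ g) := by
  refine Subtype.ext (LinearEquiv.ext fun p => ?_)
  obtain ⟨w, rfl⟩ : ∃ w, adelicFrame F E σ hσδ hδ hd V b w = p :=
    ⟨(adelicFrame F E σ hσδ hδ hd V b).symm p, (adelicFrame F E σ hσδ hδ hd V b).apply_symm_apply p⟩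
  rw [coe_frameSp, frameConj_apply_adelicFrame, coe_adelicUnitaryToSp,
    adelicFrame_apply_eq_resAut_frameUnitary F E σ hσδ hδ hd V b Φ hΦ₁ hΦ₂, ← reIm_frameCoord F E σ hσδ hδ hd V b w,
    adelicToSymplectic_reIm, coe_frameUnitary', (isQuadraticCoordinates_adele E σ hσδ hδ hd).resAut_reIm]

end Compatibility

end Prop311

end Literature.NumberTheory.GelbartRogawski1991

end
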